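import Mathlib
import HarnessLib
import Summits.ValiantsHypothesis.ValiantsHypothesis.Theses.MonotoneRestoration
import Literature.Computability.AlgebraicComplexity.ArithCircuit
import Literature.Computability.AlgebraicComplexity.ArithCircuitProofs
import Literature.Computability.AlgebraicComplexity.MonotoneStructure
import Literature.Computability.AlgebraicComplexity.PermanentIrreducible
import Literature.ModelTheory.FiniteModelTheory.CkEquiv
import Summits.ValiantsHypothesis.ValiantsHypothesis.Theorems.MonotoneRestorationMonotoneRestorationQPCosetCount
import Summits.ValiantsHypothesis.ValiantsHypothesis.Theorems.MonotoneRestorationMonotoneRestorationQPSymmetricLB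
import Summits.ValiantsHypothesis.ValiantsHypothesis.Theorems.MonotoneRestorationMonotoneRestorationQPSupportSymmetrisation
import Summits.ValiantsHypothesis.ValiantsHypothesis.Theorems.MonotoneRestorationMonotoneRestorationQPSparseRegime
import Summits.ValiantsHypothesis.ValiantsHypothesis.Theorems.MonotoneRestorationMonotoneRestorationQPBeta
import Literature.Computability.AlgebraicComplexity.SymmetricArithCircuit
import Literature.Computability.AlgebraicComplexity.DawarWilsenach2025Proofs
import Literature.GroupTheory.PermutationGroups.SmallIndexSubgroups
import Summits.ValiantsHypothesis.ValiantsHypothesis.Theorems.MonotoneRestorationQP.Negative.LoadBearing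
import Summits.ValiantsHypothesis.ValiantsHypothesis.Theorems.MonotoneRestorationMonotoneRestorationQPPermSupportCount

/-! TTRL-lite variant V19855 of stmt-ValiantsHypothesis-15886 -/

-- `Summit.ValiantsHypothesis.ValiantsHypothesis.…` is the tree's mandated single-conjunct layout
-- (Sub = Summit), so the duplicated namespace component is intended.
set_option linter.dupNamespace false

namespace Summit.ValiantsHypothesis.ValiantsHypothesis.Theorems

open Summit.ValiantsHypothesis.ValiantsHypothesis.Theses.MonotoneRestoration
open Literature.Computability.AlgebraicComplexity

/-- **TTRL-lite variant V19855 of `stub_mulGate_children_extend`** (monotone divisibility is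
extension): over `ℝ≥0`, if `p ∣ f` and `f ≠ 0`, then there is a single shift `μ` carrying every
monomial of `p` into the support of `f`. Write `f = p * q`; since `f ≠ 0` the cofactor `q` is
nonzero, so it has some monomial `μ`, and by no-cancellation (`add_mem_support_mul`) every
`m + μ` with `m ∈ supp p` is a monomial of `p * q = f`. (False over `ℤ`, where cancellation can
kill `m + μ`.) [folklore] -/
theorem stub_mulGate_children_extend_var19855 :
    ∀ (n : ℕ) (p f : MvPolynomial (Fin n × Fin n) NNReal), f ≠ 0 → p ∣ f →
      ∃ μ : (Fin n × Fin n) →₀ ℕ, ∀ m ∈ p.support, m + μ ∈ f.support := by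
  intro n p f hf hpf
  obtain ⟨q, rfl⟩ := hpf
  have hq : q ≠ 0 := by
    rintro rfl
    exact hf (mul_zero p)
  obtain ⟨μ, hμ⟩ := MvPolynomial.support_nonempty.mpr hq
  exact ⟨μ, fun m hm => add_mem_support_mul hm hμ⟩

end Summit.ValiantsHypothesis.ValiantsHypothesis.Theorems
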